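import Summits.QuantumFields.YangMills.Theorems.PencilRigidityWeakCouplingHypercubicLimitCurvFunctional
import Summits.QuantumFields.YangMills.Theorems.PencilRigidityWeakCouplingHypercubicLimitRPPairPlaneDist
import Summits.QuantumFields.YangMills.Theorems.LangevinControlUVOSLegsFromFemtoAndGapStubAssemblyRPExpansion
import Summits.QuantumFields.YangMills.Theorems.MirrorModularBoostsHypercubicLimitPlaneLimitsDefs
import Summits.QuantumFields.YangMills.Theorems.MirrorModularBoostsHypercubicLimitClosureHalvesDefs
import Summits.QuantumFields.YangMills.Theorems.LangevinControlUVOSLegsAtWeakCouplingCDefs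
import Summits.QuantumFields.YangMills.Theorems.FradkinShenkerFlowFiniteSusceptibilityWeakCouplingRPCauchySchwarz
import HarnessLib

/-!
# Crux `WeakCouplingHypercubicLimit` (stmt-QuantumFields-16120), line `Sketch`, r10 toolkit: expectation facts of
the smeared plane-string functional (sub-goal SG-H `fieldObs_expectation_facts`)

Helper file of the lead (c4) for the r10 skeleton `Cruxes/WeakCouplingHypercubicLimit/Lines/Sketch.lean`.  On the
odd torus of side `2L+1`, for the smeared multi-point plane-string functional `fieldObs r L a F m` (OSLegs toolkit
XVII: `Σ_{q valid} Σ_{y ∈ boxⁿ} F(a y) ∏ₗ (plane (q l) (y l) − m (q l))`) under Wilson's torus state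
`μ = wilsonMeasure r.ρ β`:

1. the mean of the RENORMALISED functional at step `k` of a scaling scheme (test function `(c_k a_k⁴)ⁿ • F`,
   counterterms `m_k / 6`) is the finite sum over plane strings `q : Fin n → Plane` of the twin's renormalised
   plane-string distributions `planeDist r sch k n q F` (termwise integration, `∫ strObs = torusMomentStr`,
   `latticeDistStr_apply`, reindexing valid strings by maps into `Plane`);
2. the functional is real for real test functions (the string observables are real);
3. `μ` is invariant under the torus time reflection `GaugeConfig.timeReflect`
   (`RPCauchySchwarz.wilsonMeasure_map_timeReflect`, a measurable involution);
4. `μ`-means are invariant under time translation of the test function by a lattice vector `(j a) e₀` as long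
   as the lattice support and its translate stay in the box: translating the test function is translating the
   `ℤ⁴`-configuration (`curvFunctional_configShift`, here without the positivity of the spacing), the periodic
   lift intertwines it with a torus translation (`toTorusObservable_comp_configShift`), and `μ` is translation
   invariant (`wilsonMeasure_map_torusConfigShift`).

Refs: OsterwalderSeiler1978 §§2–3; GlimmJaffe1987 §6.1.
-/

noncomputable section

open scoped SchwartzMap BigOperators ComplexConjugate
open MeasureTheory Filter Topology
open Literature.MathematicalPhysics.QuantumFieldTheory Literature.MathematicalPhysics.QuantumLattice
open Literature.MathematicalPhysics.AQFT
open Literature.Probability.LatticeModels (box Site)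
open Summit.QuantumFields.YangMills.Cruxes.HypercubicLimit.CouplingResponse
open Summit.QuantumFields.YangMills.Cruxes.OSLegsFromFemtoAndGap.DlrCollarTransfer (plane conn Decay RPPos ConnCS)
open Summit.QuantumFields.YangMills.Cruxes.OSLegsAtWeakCouplingC.Sketch (Separated)
open Summit.QuantumFields.YangMills.Theorems.OSLegsFromFemtoAndGap

namespace Summit.QuantumFields.YangMills.Theorems.WeakCouplingHypercubicLimit.TraceNormColdPressure

section Helpers

variable {G : Type} [Group G] [TopologicalSpace G] [IsTopologicalGroup G] [CompactSpace G]
  [MeasurableSpace G] [BorelSpace G]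

/-- **The mean of the smeared plane-string field as a sum over maps into `Plane`**:
`E[fieldObs a F m] = Σ_{q : Fin n → Plane} latticeDistStr (plaquetteObs ∘ q) (m ∘ q) F` (termwise integration,
`∫ strObs = torusMomentStr`, `latticeDistStr_apply`, `sum_planeStrings_eq_sum_plane`). [folklore] -/
theorem integral_fieldObs_eq_sum_latticeDistStr (r : LatticeRep G) (β : ℝ) (L : ℕ) (a : ℝ) {n : ℕ}
    (F : 𝓢((Fin n → EuclideanSpace ℝ (Fin 4)), ℂ)) (m : Fin 4 × Fin 4 → ℝ) :
    ∫ U, fieldObs r L a F m U ∂(wilsonMeasure r.ρ β : Measure (GaugeConfig 4 (2 * L + 1) G)) =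
      ∑ q : Fin n → Plane, latticeDistStr r.ρ β L a (fun l => plaquetteObs r.ρ 0 (q l).1.1 (q l).1.2)
        (fun l => m (q l).1) F := by
  -- adapted from `OSLegsAtWeakCouplingC.integral_fieldObs` (stub_rope helpers IV)
  unfold fieldObs
  rw [integral_finsetSum _ fun q _ => integrable_finsetSum _ fun y _ =>
    (integrable_strObs r β L q _ y).ofReal.const_mul _, sum_planeStrings_eq_sum_plane]
  refine Finset.sum_congr rfl fun q _ => ?_
  rw [latticeDistStr_apply, integral_finsetSum _ fun y _ => (integrable_strObs r β L _ _ y).ofReal.const_mul _]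
  refine Finset.sum_congr rfl fun y _ => ?_
  rw [integral_const_mul, integral_complex_ofReal, integral_strObs, mul_comm]

omit [IsTopologicalGroup G] [CompactSpace G] [BorelSpace G] in
/-- **The smeared plane-string field of a real test function is real** (the string observables are real).
[folklore] -/
theorem conj_fieldObs (r : LatticeRep G) (L : ℕ) (a : ℝ) {n : ℕ} (F : 𝓢((Fin n → EuclideanSpace ℝ (Fin 4)), ℂ))
    (m : Fin 4 × Fin 4 → ℝ) (hF : ∀ x, conj (F x) = F x) (U : GaugeConfig 4 (2 * L + 1) G) :
    conj (fieldObs r L a F m U) = fieldObs r L a F m U := by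
  unfold fieldObs
  simp only [map_sum, map_mul, Complex.conj_ofReal, hF]

/-- **Wilson's torus state is time-reflection invariant** (integral form of
`RPCauchySchwarz.wilsonMeasure_map_timeReflect`; `GaugeConfig.timeReflect` is a measurable involution, so no
measurability of the integrand is needed). [folklore] -/
theorem integral_comp_timeReflect_eq (r : LatticeRep G) (L : ℕ) (β : ℝ) (f : GaugeConfig 4 (2 * L + 1) G → ℂ) :
    ∫ U, f (GaugeConfig.timeReflect U) ∂(wilsonMeasure r.ρ β : Measure (GaugeConfig 4 (2 * L + 1) G)) =
      ∫ U, f U ∂(wilsonMeasure r.ρ β : Measure (GaugeConfig 4 (2 * L + 1) G)) := by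
  have he : ⇑(MeasurableEquiv.ofInvolutive (GaugeConfig.timeReflect (d := 4) (L := 2 * L + 1) (G := G))
      FiniteSusceptibilityWeakCoupling.RPCauchySchwarz.timeReflect_timeReflect WilsonRP.measurable_timeReflect) =
      GaugeConfig.timeReflect := rfl
  rw [← he, ← integral_map_equiv, he,
    FiniteSusceptibilityWeakCoupling.RPCauchySchwarz.wilsonMeasure_map_timeReflect r.ρ r.continuous β]

/-- **Wilson's torus state is translation invariant** (integral form of `wilsonMeasure_map_torusConfigShift`).
[folklore] -/
theorem integral_comp_torusConfigShift_eq (r : LatticeRep G) (L : ℕ) (β : ℝ)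
    (v : Literature.MathematicalPhysics.QuantumFieldTheory.Site 4 (2 * L + 1)) (f : GaugeConfig 4 (2 * L + 1) G → ℂ) :
    ∫ U, f (torusConfigShift v U) ∂(wilsonMeasure r.ρ β : Measure (GaugeConfig 4 (2 * L + 1) G)) =
      ∫ U, f U ∂(wilsonMeasure r.ρ β : Measure (GaugeConfig 4 (2 * L + 1) G)) := by
  rw [← integral_map_equiv, wilsonMeasure_map_torusConfigShift r.ρ β v]

omit [IsTopologicalGroup G] [CompactSpace G] [BorelSpace G] in
/-- **Time-translating the configuration is time-translating the test function** in the smeared plane-string sum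
(`curvFunctional_configShift` of the same toolkit, whose positivity hypothesis on the spacing is not used: reindex
`y ↦ y + j e₀` on the non-zero terms, which stay in the box by hypothesis). [folklore] -/
theorem sum_configShift_eq_sum_translateMulti (r : LatticeRep G) (L : ℕ) (a : ℝ) {n : ℕ} (j : ℕ)
    (F : 𝓢((Fin n → EuclideanSpace ℝ (Fin 4)), ℂ)) (m : Fin 4 × Fin 4 → ℝ)
    (hF : ∀ y : Fin n → Site 4, F (fun l => a • siteToE (y l)) ≠ 0 →
      ∀ l, y l ∈ box 4 L ∧ y l + Pi.single 0 (j : ℤ) ∈ box 4 L) (V : LGConfig 4 G) :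
    (∑ q ∈ Fintype.piFinset (fun _ : Fin n => Finset.univ.filter fun p : Fin 4 × Fin 4 => p.1 < p.2),
      ∑ y ∈ Fintype.piFinset (fun _ : Fin n => box 4 L),
        F (fun l => a • siteToE (y l)) *
          ((∏ l, (plane G r (q l) (y l) (configShift (-Pi.single 0 (j : ℤ)) V) - m (q l)) : ℝ) : ℂ)) =
    ∑ q ∈ Fintype.piFinset (fun _ : Fin n => Finset.univ.filter fun p : Fin 4 × Fin 4 => p.1 < p.2),
      ∑ y ∈ Fintype.piFinset (fun _ : Fin n => box 4 L),
        translateMulti (((j : ℝ) * a) • EuclideanSpace.single (0 : Fin 4) (1 : ℝ)) F (fun l => a • siteToE (y l)) *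
          ((∏ l, (plane G r (q l) (y l) V - m (q l)) : ℝ) : ℂ) := by
  -- adapted from `curvFunctional_configShift` (sub-goal SG-B0, same namespace), minus the unused `0 < a`
  refine Finset.sum_congr rfl fun q _ => ?_
  have htr : ∀ y : Fin n → Site 4,
      (fun l => a • siteToE (y l) - ((j : ℝ) * a) • EuclideanSpace.single (0 : Fin 4) (1 : ℝ)) =
        fun l => a • siteToE (y l - Pi.single 0 (j : ℤ)) :=
    fun y => funext fun l => smul_siteToE_sub_single a j (y l)
  simp_rw [plane_configShift, translateMulti_apply, htr]
  -- reindex `y ↦ y + j e₀` on the non-zero terms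
  refine Finset.sum_bij_ne_zero (fun y _ _ => fun l => y l + Pi.single 0 (j : ℤ)) (fun y _ hne => ?_)
    (fun y₁ _ _ y₂ _ _ h => funext fun l => add_right_cancel (congrFun h l)) (fun y' _ hne => ?_)
    (fun y _ _ => by simp only [add_sub_cancel_right])
  · have hF0 : F (fun l => a • siteToE (y l)) ≠ 0 := fun h => hne (by rw [h, zero_mul])
    exact Fintype.mem_piFinset.2 fun l => (hF y hF0 l).2
  · have hF0 : F (fun l => a • siteToE (y' l - Pi.single 0 (j : ℤ))) ≠ 0 :=
      fun h => hne (by rw [h, zero_mul])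
    exact ⟨fun l => y' l - Pi.single 0 (j : ℤ), Fintype.mem_piFinset.2 fun l => (hF _ hF0 l).1,
      by simpa only [sub_add_cancel] using hne, funext fun l => sub_add_cancel _ _⟩

omit [Group G] [TopologicalSpace G] [IsTopologicalGroup G] [CompactSpace G] [BorelSpace G] in
/-- **The periodic lift intertwines the translations** of the torus and of `ℤ⁴`:
`lift (τ_{proj w} U) = configShift w (lift U)` (`toTorusObservable_comp_configShift` at `F = id`). [folklore] -/
theorem torusLift_torusConfigShift_proj (S : ℕ) (w : Site 4) (U : GaugeConfig 4 S G) :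
    torusLift S (torusConfigShift (Literature.Probability.LatticeModels.Torus.proj S w) U) =
      configShift w (torusLift S U) := by
  have h := toTorusObservable_comp_configShift (G := G) S w (id : LGConfig 4 G → LGConfig 4 G)
  exact (congrFun h U).symm

omit [IsTopologicalGroup G] [CompactSpace G] [BorelSpace G] in
/-- **Time translation of the test function is a torus translation of the configuration**:
`fieldObs a (T_{(j a) e₀} F) m U = fieldObs a F m (τ_{proj (−j e₀)} U)` when the lattice support of `F` and its
translate by `j e₀` stay in the box (`sum_configShift_eq_sum_translateMulti` read through the periodic lift,
`torusLift_torusConfigShift_proj`). [folklore] -/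
theorem fieldObs_translateMulti_eq (r : LatticeRep G) (L : ℕ) (a : ℝ) {n : ℕ} (j : ℕ)
    (F : 𝓢((Fin n → EuclideanSpace ℝ (Fin 4)), ℂ)) (m : Fin 4 × Fin 4 → ℝ)
    (hF : ∀ y : Fin n → Site 4, F (fun l => a • siteToE (y l)) ≠ 0 →
      ∀ l, y l ∈ box 4 L ∧ y l + Pi.single 0 (j : ℤ) ∈ box 4 L) (U : GaugeConfig 4 (2 * L + 1) G) :
    fieldObs r L a (translateMulti (((j : ℝ) * a) • EuclideanSpace.single (0 : Fin 4) (1 : ℝ)) F) m U =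
      fieldObs r L a F m (torusConfigShift
        (Literature.Probability.LatticeModels.Torus.proj (2 * L + 1) (-Pi.single 0 (j : ℤ))) U) := by
  unfold fieldObs strObs
  rw [torusLift_torusConfigShift_proj]
  exact (sum_configShift_eq_sum_translateMulti r L a j F m hF (torusLift (2 * L + 1) U)).symm

end Helpers

/-- **Registered sub-goal SG-H `fieldObs_expectation_facts` (line `Sketch`, r10).**  Expectation facts of the
smeared plane-string functional at step `k`: (1) the mean of the renormalised functional is the sum of the twin's
renormalised plane-string distributions `Σ_q planeDist r sch k n q F`; (2) it is real for real test functions;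
(3) Wilson's torus state is time-reflection invariant; (4) and translation invariant: translating the test
function by the lattice time vector `(j a) e₀` does not change the mean (support and its translate inside the box).
[folklore] -/
theorem fieldObs_expectation_facts :
    ∀ (G : Type) [Group G] [TopologicalSpace G] [IsTopologicalGroup G] [CompactSpace G]
      [MeasurableSpace G] [BorelSpace G] (r : LatticeRep G),
    (∀ (sch : SpeciesScheme (YMSpecies G)) (k n : ℕ) (F : 𝓢((Fin n → EuclideanSpace ℝ (Fin 4)), ℂ)),
      ∫ U, fieldObs r (sch.L k) (sch.a k) ((((sch.c r.curvature k * sch.a k ^ 4) ^ n : ℝ) : ℂ) • F)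
          (fun _ => sch.m r.curvature k / 6) U
        ∂(wilsonMeasure r.ρ (sch.β k) : Measure (GaugeConfig 4 (2 * sch.L k + 1) G)) =
      ∑ q : Fin n → Plane, planeDist r sch k n q F) ∧
    (∀ (L : ℕ) (a : ℝ) (n : ℕ) (F : 𝓢((Fin n → EuclideanSpace ℝ (Fin 4)), ℂ)) (m : Fin 4 × Fin 4 → ℝ),
      (∀ x, conj (F x) = F x) → ∀ U : GaugeConfig 4 (2 * L + 1) G, conj (fieldObs r L a F m U) = fieldObs r L a F m U) ∧
    (∀ (L : ℕ) (β : ℝ) (f : GaugeConfig 4 (2 * L + 1) G → ℂ),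
      ∫ U, f (GaugeConfig.timeReflect U) ∂(wilsonMeasure r.ρ β : Measure (GaugeConfig 4 (2 * L + 1) G)) =
        ∫ U, f U ∂(wilsonMeasure r.ρ β : Measure (GaugeConfig 4 (2 * L + 1) G))) ∧
    (∀ (L : ℕ) (β a : ℝ) (n j : ℕ) (F : 𝓢((Fin n → EuclideanSpace ℝ (Fin 4)), ℂ)) (m : Fin 4 × Fin 4 → ℝ),
      (∀ y : Fin n → Site 4, F (fun l => a • siteToE (y l)) ≠ 0 →
        ∀ l, y l ∈ box 4 L ∧ y l + Pi.single 0 (j : ℤ) ∈ box 4 L) →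
      ∫ U, fieldObs r L a (translateMulti (((j : ℝ) * a) • EuclideanSpace.single (0 : Fin 4) (1 : ℝ)) F) m U
          ∂(wilsonMeasure r.ρ β : Measure (GaugeConfig 4 (2 * L + 1) G)) =
        ∫ U, fieldObs r L a F m U ∂(wilsonMeasure r.ρ β : Measure (GaugeConfig 4 (2 * L + 1) G))) := by
  intro G _ _ _ _ _ _ r
  refine ⟨fun sch k n F => ?_, fun L a n F m hF U => conj_fieldObs r L a F m hF U,
    fun L β f => integral_comp_timeReflect_eq r L β f, fun L β a n j F m hF => ?_⟩
  · -- (1) the mean of the renormalised functional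
    rw [integral_fieldObs_eq_sum_latticeDistStr]
    refine Finset.sum_congr rfl fun q _ => ?_
    simp only [planeDist, map_smul, smul_apply, planeSpecies_F, smul_eq_mul]
  · -- (4) translation invariance of the mean
    simp only [fieldObs_translateMulti_eq r L a j F m hF]
    exact integral_comp_torusConfigShift_eq r L β _ (fieldObs r L a F m)

end Summit.QuantumFields.YangMills.Theorems.WeakCouplingHypercubicLimit.TraceNormColdPressure

end
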